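import Mathlib
import Summits.ValiantsHypothesis.ValiantsHypothesis.Theorems.MonotoneRestorationOrbitRestorationQPValueOrbitRowSums
import HarnessLib

/-!
# Polynomial expressions in orbit-restorable values; power sums of row and column sums (ORBIT currency)

Route MonotoneRestoration, crux `OrbitRestorationQP` (stmt-ValiantsHypothesis-18293), line `depth-three-rung`, registered stub
`stub_sigmaPiSigmaValue` (A_∞).  Namespace `Summit.ValiantsHypothesis.ValiantsHypothesis.Theorems.RowColumnRestorable`.
Definition-free.

The companion of the row/column dichotomy (`Theorems/MonotoneRestorationOrbitRestorationQP{RowColumnDichotomy,RowColumnEssential}.lean`: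
below `(n−1)²` wires into the product layer, a matrix-symmetric depth-three polynomial is a polynomial in the row sums `r_i` and the
column sums `c_j`).  Here: the restoration side.

* `qpOrbitRestorable_of_mem_adjoin` — **POLYNOMIAL EXPRESSIONS IN RESTORABLE VALUES ARE RESTORABLE AT FLAT COST**: if every
  `t ∈ T` is `QPOrbitRestorable c n t`, then every element of the subalgebra `ℂ[T]` is `QPOrbitRestorable (c + 3) n` — whatever the
  size of the expression.  (Restorable values are diagonally invariant, so every new intermediate value of the expression is
  invariant and has a one-point orbit; compare `ValueOrbit.qpOrbitRestorable_add/mul`, which cost `+3` PER operation.)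
* `rowPowerSum_qpOrbitRestorable` / `colPowerSum_qpOrbitRestorable` — the power sums `Σ_i r_i^k`, `Σ_j c_j^k` of the row sums and of
  the column sums are `QPOrbitRestorable 6 n` for every `k` (affine product terms `r_i · … · r_i` of orbit `≤ n`);
* `qpOrbitRestorable_aeval` — flat-cost corollary: arbitrary polynomial expressions `Q(g_1, …, g_m)` in restorable values cost `+3`
  in total (finite sums and products: `ValueOrbit.qpOrbitRestorable_finset_sum/prod`, `…ValueOrbitFinset.lean`);
* `qpOrbitRestorable_of_mem_adjoin_powerSums` — hence every polynomial in these power sums is `QPOrbitRestorable 9 n` (by Newton's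
  identities in characteristic `0` this is the whole algebra `ℂ[r]^{Sym} · ℂ[c]^{Sym}` of polynomials in the elementary symmetric
  polynomials of the row sums and of the column sums).

What remains between this file and the sub-quadratic stratum of A_∞ is pure algebra: a MATRIX-SYMMETRIC element of `ℂ[r, c]` lies in
`ℂ[power sums of r, power sums of c]` (bi-symmetric averaging + the fundamental theorem of symmetric polynomials in two blocks of
variables + Newton).  Nothing here bears on VP ≠ VNP. [folklore]

## References
* A. Dawar, G. Wilsenach, *Symmetric arithmetic circuits*, ToC 21 (2025), §3.3. [DawarWilsenach2025]
-/

noncomputable section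

open scoped Classical

-- `Summit.ValiantsHypothesis.ValiantsHypothesis.…` is the tree's single-conjunct layout (Sub = Summit).
set_option linter.dupNamespace false

namespace Summit.ValiantsHypothesis.ValiantsHypothesis.Theorems

namespace RowColumnRestorable

open Finset Literature.Computability.AlgebraicComplexity OrbitRestorationQPDepthThreeRung MvPolynomial ValueProducts

variable {n : ℕ}

/-! ### Polynomial expressions in restorable values -/

/-- **Polynomial expressions in orbit-restorable values are orbit-restorable, at flat cost `+3`.** [folklore] -/
theorem qpOrbitRestorable_of_mem_adjoin {c : ℕ} {T : Set (MvPolynomial (Fin n × Fin n) ℂ)}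
    (hT : ∀ t ∈ T, QPOrbitRestorable c n t) {p : MvPolynomial (Fin n × Fin n) ℂ}
    (hp : p ∈ Algebra.adjoin ℂ T) : QPOrbitRestorable (c + 3) n p := by
  have hB : 1 ≤ 2 ^ ((Nat.log 2 n + c) ^ c) := Nat.one_le_two_pow
  have key : (∀ σ : Equiv.Perm (Fin n), ren σ p = p) ∧ ∃ 𝒟 : ValueDerivation ℂ (Fin n × Fin n), p ∈ 𝒟.S ∧
      ∀ q ∈ 𝒟.S, (Set.range fun σ : Equiv.Perm (Fin n) => ren σ q).ncard ≤ 2 ^ ((Nat.log 2 n + c) ^ c) := by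
    induction hp using Algebra.adjoin_induction with
    | mem t ht => exact ValueOrbit.exists_valueDerivation_of_qpOrbitRestorable (hT t ht)
    | algebraMap r =>
      rw [MvPolynomial.algebraMap_eq]
      have hfix : ∀ σ : Equiv.Perm (Fin n), ren σ (C r : MvPolynomial (Fin n × Fin n) ℂ) = C r := fun σ => ren_C σ r
      refine ⟨hfix, ⟨{C r}, fun _ => 0, fun q hq => ⟨StepData.const r, ⟨?_, fun u hu => ?_⟩⟩⟩, Finset.mem_singleton_self _,
        fun q hq => ?_⟩
      · rw [Finset.mem_singleton.1 hq]; rfl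
      · exact absurd hu (Multiset.notMem_zero u)
      · rw [Finset.mem_singleton.1 hq]
        exact (ValueOrbit.ncard_orbit_of_invariant hfix).trans hB
    | add x y hx hy ihx ihy =>
      obtain ⟨hxi, 𝒟₁, hx1, hS1⟩ := ihx
      obtain ⟨hyi, 𝒟₂, hy2, hS2⟩ := ihy
      have hfix : ∀ σ : Equiv.Perm (Fin n), ren σ (x + y) = x + y := fun σ => by rw [map_add, hxi, hyi]
      have hx' : x ∈ (𝒟₁.union 𝒟₂).S := ValueDerivation.mem_union_S_left hx1
      have hy' : y ∈ (𝒟₁.union 𝒟₂).S := ValueDerivation.mem_union_S_right hy2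
      refine ⟨hfix, (𝒟₁.union 𝒟₂).addStep x y hx' hy', ValueDerivation.mem_addStep_S.2 (Or.inl rfl), ?_⟩
      intro r hr
      rcases ValueDerivation.mem_addStep_S.1 hr with rfl | hr
      · exact (ValueOrbit.ncard_orbit_of_invariant hfix).trans hB
      rcases ValueDerivation.mem_union_S.1 hr with hr | hr
      · exact hS1 r hr
      · exact hS2 r hr
    | mul x y hx hy ihx ihy =>
      obtain ⟨hxi, 𝒟₁, hx1, hS1⟩ := ihx
      obtain ⟨hyi, 𝒟₂, hy2, hS2⟩ := ihy
      have hfix : ∀ σ : Equiv.Perm (Fin n), ren σ (x * y) = x * y := fun σ => by rw [map_mul, hxi, hyi]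
      have hx' : x ∈ (𝒟₁.union 𝒟₂).S := ValueDerivation.mem_union_S_left hx1
      have hy' : y ∈ (𝒟₁.union 𝒟₂).S := ValueDerivation.mem_union_S_right hy2
      refine ⟨hfix, (𝒟₁.union 𝒟₂).mulStep x y hx' hy', ValueDerivation.mem_mulStep_S.2 (Or.inl rfl), ?_⟩
      intro r hr
      rcases ValueDerivation.mem_mulStep_S.1 hr with rfl | hr
      · exact (ValueOrbit.ncard_orbit_of_invariant hfix).trans hB
      rcases ValueDerivation.mem_union_S.1 hr with hr | hr
      · exact hS1 r hr
      · exact hS2 r hr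
  obtain ⟨hfix, 𝒟, hpS, hS⟩ := key
  unfold QPOrbitRestorable
  exact ValueOrbit.qpOrbit_of_valueDerivation 𝒟 hpS hfix hS

/-! ### Power sums of the row sums and of the column sums -/

/-- `n ≤ 2^((log₂ n + 1)^1)`. [folklore] -/
theorem le_bound_one (n : ℕ) : n ≤ 2 ^ ((Nat.log 2 n + 1) ^ 1) := by
  rw [pow_one]; exact (Nat.lt_pow_succ_log_self Nat.one_lt_two n).le

/-- A range indexed by the rows has at most `n` elements. [folklore] -/
theorem ncard_range_fin_le {β : Type*} (g : Fin n → β) : (Set.range g).ncard ≤ n := by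
  rw [← Set.image_univ]
  refine (Set.ncard_image_le (Set.toFinite _)).trans ?_
  rw [Set.ncard_univ, Nat.card_eq_fintype_card, Fintype.card_fin]

/-- **The power sums `Σ_i r_i^k` of the row sums are `QPOrbitRestorable 6`.** [folklore] -/
theorem rowPowerSum_qpOrbitRestorable (n k : ℕ) :
    QPOrbitRestorable 6 n (∑ i : Fin n, (∑ j : Fin n, (X (i, j) : MvPolynomial (Fin n × Fin n) ℂ)) ^ k) := by
  have hrow : ∀ (s : Fin n) (i : Fin k),
      affineForm (fun _ _ => (0 : ℂ)) (fun (s : Fin n) (_ : Fin k) => ValueProducts.rowW n () s) s i = ∑ j : Fin n, X (s, j) :=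
    fun s _ => ValueProducts.affineForm_row n s
  refine qpOrbitRestorable_of_affineProductTerms (τ := Fin n) (ι := Fin k) (c := 1) (fun _ _ => (0 : ℂ))
    (fun (s : Fin n) (_ : Fin k) => ValueProducts.rowW n () s) (fun _ => 1) (fun s i => ?_) (fun s => ?_)
    (f := ∑ i : Fin n, (∑ j : Fin n, (X (i, j) : MvPolynomial (Fin n × Fin n) ℂ)) ^ k) ?_ ?_
  · -- each row sum has orbit `≤ n`
    refine le_trans ?_ (le_bound_one n)
    have hsub : (Set.range fun σ : Equiv.Perm (Fin n) =>
        ren σ (affineForm (fun _ _ => (0 : ℂ)) (fun (s : Fin n) (_ : Fin k) => ValueProducts.rowW n () s) s i)) ⊆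
        Set.range fun i' : Fin n => ∑ j : Fin n, (X (i', j) : MvPolynomial (Fin n × Fin n) ℂ) := by
      rintro _ ⟨σ, rfl⟩
      exact ⟨σ s, by simp only [hrow, ValueProducts.ren_rowSum]⟩
    exact (Set.ncard_le_ncard hsub (Set.finite_range _)).trans (ncard_range_fin_le _)
  · -- the factor multiset `{r_s, …, r_s}` has orbit `≤ n`
    refine le_trans ?_ (le_bound_one n)
    have hms : ∀ σ : Equiv.Perm (Fin n),
        ((univ : Finset (Fin k)).val.map (affineForm (fun _ _ => (0 : ℂ)) (fun (s : Fin n) (_ : Fin k) => ValueProducts.rowW n () s) s)).map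
          (ren σ) = Multiset.replicate k (∑ j : Fin n, (X (σ s, j) : MvPolynomial (Fin n × Fin n) ℂ)) := by
      intro σ
      rw [Multiset.map_map]
      have hc : (ren σ) ∘ affineForm (fun _ _ => (0 : ℂ)) (fun (s : Fin n) (_ : Fin k) => ValueProducts.rowW n () s) s =
          fun (_ : Fin k) => ∑ j : Fin n, (X (σ s, j) : MvPolynomial (Fin n × Fin n) ℂ) := by
        funext i
        simp only [Function.comp_apply, hrow, ValueProducts.ren_rowSum]
      rw [hc, Multiset.map_const', Finset.card_val, Finset.card_univ, Fintype.card_fin]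
    have hsub : (Set.range fun σ : Equiv.Perm (Fin n) =>
        ((univ : Finset (Fin k)).val.map (affineForm (fun _ _ => (0 : ℂ)) (fun (s : Fin n) (_ : Fin k) => ValueProducts.rowW n () s) s)).map
          (ren σ)) ⊆
        Set.range fun i' : Fin n => Multiset.replicate k (∑ j : Fin n, (X (i', j) : MvPolynomial (Fin n × Fin n) ℂ)) := by
      rintro _ ⟨σ, rfl⟩
      exact ⟨σ s, (hms σ).symm⟩
    exact (Set.ncard_le_ncard hsub (Set.finite_range _)).trans (ncard_range_fin_le _)
  · simp only [hrow, Finset.prod_const, Finset.card_univ, Fintype.card_fin, map_one, one_mul]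
  · intro σ
    rw [map_sum]
    simp only [map_pow, ValueProducts.ren_rowSum]
    exact Equiv.sum_comp σ (fun i => (∑ j : Fin n, (X (i, j) : MvPolynomial (Fin n × Fin n) ℂ)) ^ k)

/-- Coefficients of the column sums: `colW () j x = [x.2 = j]`. (Inline analogue of `ValueProducts.rowW`.) [folklore] -/
theorem affineForm_col (n : ℕ) (j : Fin n) :
    affineForm (τ := Unit) (fun _ _ => (0 : ℂ)) (fun _ j x => if x.2 = j then (1 : ℂ) else 0) () j =
      ∑ i : Fin n, (X (i, j) : MvPolynomial (Fin n × Fin n) ℂ) := by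
  rw [affineForm, map_zero, zero_add, ← Finset.univ_product_univ, Finset.sum_product_right]
  rw [Finset.sum_eq_single j]
  · simp
  · intro b _ hb; simp [hb]
  · intro h; exact absurd (Finset.mem_univ j) h

/-- Renaming a column sum by `σ` gives the column sum of `σ j`. [folklore] -/
theorem ren_colSum (n : ℕ) (σ : Equiv.Perm (Fin n)) (j : Fin n) :
    ren σ (∑ i : Fin n, (X (i, j) : MvPolynomial (Fin n × Fin n) ℂ)) = ∑ i : Fin n, X (i, σ j) := by
  rw [map_sum]
  simp only [ren_X]
  exact Equiv.sum_comp σ (fun i => (X (i, σ j) : MvPolynomial (Fin n × Fin n) ℂ))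

/-- **The power sums `Σ_j c_j^k` of the column sums are `QPOrbitRestorable 6`.** [folklore] -/
theorem colPowerSum_qpOrbitRestorable (n k : ℕ) :
    QPOrbitRestorable 6 n (∑ j : Fin n, (∑ i : Fin n, (X (i, j) : MvPolynomial (Fin n × Fin n) ℂ)) ^ k) := by
  have hcol : ∀ (s : Fin n) (i : Fin k),
      affineForm (fun _ _ => (0 : ℂ)) (fun (s : Fin n) (_ : Fin k) (x : Fin n × Fin n) => if x.2 = s then (1 : ℂ) else 0) s i =
        ∑ i' : Fin n, X (i', s) :=
    fun s _ => affineForm_col n s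
  refine qpOrbitRestorable_of_affineProductTerms (τ := Fin n) (ι := Fin k) (c := 1) (fun _ _ => (0 : ℂ))
    (fun (s : Fin n) (_ : Fin k) (x : Fin n × Fin n) => if x.2 = s then (1 : ℂ) else 0) (fun _ => 1) (fun s i => ?_)
    (fun s => ?_) (f := ∑ j : Fin n, (∑ i : Fin n, (X (i, j) : MvPolynomial (Fin n × Fin n) ℂ)) ^ k) ?_ ?_
  · refine le_trans ?_ (le_bound_one n)
    have hsub : (Set.range fun σ : Equiv.Perm (Fin n) =>
        ren σ (affineForm (fun _ _ => (0 : ℂ))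
          (fun (s : Fin n) (_ : Fin k) (x : Fin n × Fin n) => if x.2 = s then (1 : ℂ) else 0) s i)) ⊆
        Set.range fun j' : Fin n => ∑ i' : Fin n, (X (i', j') : MvPolynomial (Fin n × Fin n) ℂ) := by
      rintro _ ⟨σ, rfl⟩
      exact ⟨σ s, by simp only [hcol, ren_colSum]⟩
    exact (Set.ncard_le_ncard hsub (Set.finite_range _)).trans (ncard_range_fin_le _)
  · refine le_trans ?_ (le_bound_one n)
    have hms : ∀ σ : Equiv.Perm (Fin n),
        ((univ : Finset (Fin k)).val.map (affineForm (fun _ _ => (0 : ℂ))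
          (fun (s : Fin n) (_ : Fin k) (x : Fin n × Fin n) => if x.2 = s then (1 : ℂ) else 0) s)).map (ren σ) =
          Multiset.replicate k (∑ i' : Fin n, (X (i', σ s) : MvPolynomial (Fin n × Fin n) ℂ)) := by
      intro σ
      rw [Multiset.map_map]
      have hc : (ren σ) ∘ affineForm (fun _ _ => (0 : ℂ))
          (fun (s : Fin n) (_ : Fin k) (x : Fin n × Fin n) => if x.2 = s then (1 : ℂ) else 0) s =
          fun (_ : Fin k) => ∑ i' : Fin n, (X (i', σ s) : MvPolynomial (Fin n × Fin n) ℂ) := by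
        funext i
        simp only [Function.comp_apply, hcol, ren_colSum]
      rw [hc, Multiset.map_const', Finset.card_val, Finset.card_univ, Fintype.card_fin]
    have hsub : (Set.range fun σ : Equiv.Perm (Fin n) =>
        ((univ : Finset (Fin k)).val.map (affineForm (fun _ _ => (0 : ℂ))
          (fun (s : Fin n) (_ : Fin k) (x : Fin n × Fin n) => if x.2 = s then (1 : ℂ) else 0) s)).map (ren σ)) ⊆
        Set.range fun j' : Fin n => Multiset.replicate k (∑ i' : Fin n, (X (i', j') : MvPolynomial (Fin n × Fin n) ℂ)) := by
      rintro _ ⟨σ, rfl⟩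
      exact ⟨σ s, (hms σ).symm⟩
    exact (Set.ncard_le_ncard hsub (Set.finite_range _)).trans (ncard_range_fin_le _)
  · simp only [hcol, Finset.prod_const, Finset.card_univ, Fintype.card_fin, map_one, one_mul]
  · intro σ
    rw [map_sum]
    simp only [map_pow, ren_colSum]
    exact Equiv.sum_comp σ (fun j => (∑ i : Fin n, (X (i, j) : MvPolynomial (Fin n × Fin n) ℂ)) ^ k)

/-- **Every polynomial in the power sums of the row sums and of the column sums is `QPOrbitRestorable 9`.** [folklore] -/
theorem qpOrbitRestorable_of_mem_adjoin_powerSums {p : MvPolynomial (Fin n × Fin n) ℂ}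
    (hp : p ∈ Algebra.adjoin ℂ
      ((Set.range fun k : ℕ => ∑ i : Fin n, (∑ j : Fin n, (X (i, j) : MvPolynomial (Fin n × Fin n) ℂ)) ^ k) ∪
        Set.range fun k : ℕ => ∑ j : Fin n, (∑ i : Fin n, (X (i, j) : MvPolynomial (Fin n × Fin n) ℂ)) ^ k)) :
    QPOrbitRestorable 9 n p := by
  refine qpOrbitRestorable_of_mem_adjoin (c := 6) (fun t ht => ?_) hp
  rcases ht with ⟨k, rfl⟩ | ⟨k, rfl⟩
  · exact rowPowerSum_qpOrbitRestorable n k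
  · exact colPowerSum_qpOrbitRestorable n k

/-! ### Flat-cost corollary: polynomial expressions (finite sums / products: `ValueOrbit.qpOrbitRestorable_finset_sum/prod`) -/

/-- **Polynomial expressions `Q(g_1, …, g_m)` in restorable polynomials are restorable at flat cost `+3`**, for every
`Q ∈ ℂ[y_ι]`. [folklore] -/
theorem qpOrbitRestorable_aeval {c : ℕ} {ι : Type*} (g : ι → MvPolynomial (Fin n × Fin n) ℂ)
    (h : ∀ i, QPOrbitRestorable c n (g i)) (Q : MvPolynomial ι ℂ) : QPOrbitRestorable (c + 3) n (aeval g Q) := by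
  refine qpOrbitRestorable_of_mem_adjoin (T := Set.range g) ?_ ?_
  · rintro _ ⟨i, rfl⟩; exact h i
  · rw [Algebra.adjoin_range_eq_range_aeval]; exact ⟨Q, rfl⟩

end RowColumnRestorable

end Summit.ValiantsHypothesis.ValiantsHypothesis.Theorems

end
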